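import Literature.AlgebraicGeometry.Resolution.RationalFunctionsToProjectiveSpaceConverse
import Literature.AlgebraicGeometry.Resolution.RationalMapBaseIdeal
import Literature.AlgebraicGeometry.Resolution.ProjectiveModelsCentresLocal
import Literature.AlgebraicGeometry.Resolution.ProjectiveModelsModification
import Literature.AlgebraicGeometry.Resolution.ProjectiveModelsJoin
import Literature.AlgebraicGeometry.Motives.ProjectiveSpaceFieldPointsBijective
import Literature.AlgebraicGeometry.Motives.RatFnFlatDescent
import Literature.AlgebraicGeometry.Motives.RatFnSpec
import HarnessLib

/-!
# Rational maps between projective models: coordinates versus centres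

Topic: `Literature/AlgebraicGeometry/Resolution`. For projective models `A`, `B` of `K/k`
(`ProjectiveModels.lean`) the birational correspondence `A ⋯→ B` can be described in two ways:
in COORDINATES — a closed `k`-immersion `B ↪ ℙⁿ_k`, homogeneous coordinates `w ∈ Kⁿ⁺¹` of the
generic point of `B`, and the vector `(w₀ : … : wₙ)` read in `K(A) ≅ K`, defined at `a ∈ A` in
the sense of `IsDefinedAt` (`RationalFunctionsToProjectiveSpace.lean`) — or INTRINSICALLY, after
Zariski–Samuel II, Ch. VI §17: `A ⋯→ B` is defined at `a` iff the local ring `𝒪_{A,a} ⊆ K` has a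
centre on `B` (`ProjModel.HasCentre`, `ProjectiveModelsCentresLocal.lean`). This file PROVES the
dictionary (Hartshorne II Thm. 7.1; Piltant 2013, §3):

* `IsDefinedAt.of_functionFieldMap` — definedness descends along flat dominant morphisms;
* `ProjModel.exists_hom_of_isDefinedAt` — on an open `W ⊆ A` where the coordinates are defined,
  the rational map is a `k`-morphism `W → B` compatible with the `K`-points (`toProjOfVec`,
  factoring through `B ↪ ℙⁿ_k`);
* `ProjModel.isDefinedAt_of_hom` — conversely a `k`-morphism `V → B` from an open `V ∋ a` of `A`
  compatible with the `K`-points forces definedness at `a` (`isDefinedAt_of_comp_eq_pointOfVec`);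
* `ProjModel.hasCentre_stalkSubring_iff_isDefinedAt` — **`𝒪_{A,a}` has a centre on `B` iff
  `(w₀ : … : wₙ)` is defined at `a`** (through `Spec 𝒪_{A,a} → B` and spreading out, Mathlib
  `spread_out_of_isGermInjective'`); hence the intrinsic indeterminacy locus
  `{a | ¬ B.HasCentre (A.stalkSubring a)}` is closed (`isClosed_setOf_not_hasCentre`) and misses
  the generic point.

Also: `Motives.ProjectiveSpace.specMap_comp_pointOfVec_left` (homogeneous coordinates are
natural in the field).

## References

* R. Hartshorne, *Algebraic Geometry* (1977), II Thm. 7.1. [Hartshorne1977]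
* O. Zariski, P. Samuel, *Commutative Algebra* II (1960), Ch. VI §17. [ZariskiSamuel1960]
* O. Piltant, RACSAM 107 (2013), §3, Lemma 3.3. [Piltant2013]
-/

noncomputable section

open CategoryTheory CategoryTheory.Limits AlgebraicGeometry TopologicalSpace IsLocalRing
open Literature.AlgebraicGeometry.Motives
open MvPolynomial HomogeneousLocalization

universe u

/-! ## Homogeneous coordinates are natural in the field -/

namespace Literature.AlgebraicGeometry.Motives.ProjectiveSpace

variable {k : Type u} [Field k] {n : ℕ} {L L' : Type u} [Field L] [Algebra k L] [Field L']
  [Algebra k L']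

attribute [local instance] MvPolynomial.gradedAlgebra ProjBaseChange.algebraBase

/-- A `k`-algebra map transforms values of polynomials coordinatewise. [folklore] -/
theorem algHom_aeval (σ : L →ₐ[k] L') (z : Fin (n + 1) → L) (g : MvPolynomial (Fin (n + 1)) k) :
    σ (aeval z g) = aeval (fun j => σ (z j)) g := by
  have h := DFunLike.congr_fun (MvPolynomial.comp_aeval (f := z) σ) g
  simpa using h

/-- `σ ∘ awayEval z = awayEval (σ ∘ z)` on `k[x]_{(t)}` for a `k`-algebra map `σ : L → L'`.
[folklore] -/
theorem algHom_comp_awayEval (σ : L →ₐ[k] L') {t : MvPolynomial (Fin (n + 1)) k} {d : ℕ}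
    (ht : t ∈ MvPolynomial.homogeneousSubmodule (Fin (n + 1)) k d) (z : Fin (n + 1) → L)
    (hz : aeval z t ≠ 0) (hσz : aeval (fun j => σ (z j)) t ≠ 0) :
    (σ : L →+* L').comp (awayEval z hz).toRingHom = (awayEval (fun j => σ (z j)) hσz).toRingHom := by
  refine RingHom.ext fun q => ?_
  obtain ⟨m, g, hg, rfl⟩ := Away.mk_surjective _ ht q
  change σ (awayEval z hz (Away.mk _ ht m g hg)) = awayEval _ hσz (Away.mk _ ht m g hg)
  rw [awayEval_mk _ _ ht, awayEval_mk _ _ ht, map_div₀, map_pow, algHom_aeval, algHom_aeval]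

/-- `σ ∘ z ≠ 0` for `z ≠ 0` (a `k`-algebra map of fields is injective). [folklore] -/
theorem algHom_comp_ne_zero (σ : L →ₐ[k] L') {z : Fin (n + 1) → L} (hz : z ≠ 0) :
    (fun j => σ (z j)) ≠ 0 := by
  obtain ⟨i, hi⟩ := Function.ne_iff.mp hz
  exact Function.ne_iff.mpr ⟨i, by simpa using hi⟩

/-- Chart form of the naturality of homogeneous coordinates. [folklore] -/
theorem specMap_comp_chartPoint_left (σ : L →ₐ[k] L') {t : MvPolynomial (Fin (n + 1)) k} {d : ℕ}
    (ht : t ∈ MvPolynomial.homogeneousSubmodule (Fin (n + 1)) k d) (hd : 0 < d)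
    (z : Fin (n + 1) → L) (hz : aeval z t ≠ 0) (hσz : aeval (fun j => σ (z j)) t ≠ 0) :
    Spec.map (CommRingCat.ofHom (σ : L →+* L')) ≫ (chartPoint ht hd z hz).left =
      (chartPoint ht hd (fun j => σ (z j)) hσz).left := by
  have h := algHom_comp_awayEval σ ht z hz hσz
  simp only [chartPoint_left, ← h, CommRingCat.ofHom_comp, Spec.map_comp, Category.assoc]
  rfl

/-- **Homogeneous coordinates are natural in the field**: for a `k`-algebra map `σ : L → L'`,
`Spec L' → Spec L → ℙⁿ_k`, the latter with homogeneous coordinates `z`, is the `L'`-point with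
homogeneous coordinates `σ ∘ z` (Hartshorne II Thm. 7.1: points of `ℙⁿ` with values in a field).
[cite: Hartshorne1977, II Thm. 7.1] -/
theorem specMap_comp_pointOfVec_left (σ : L →ₐ[k] L') (z : Fin (n + 1) → L) (hz : z ≠ 0) :
    Spec.map (CommRingCat.ofHom (σ : L →+* L')) ≫ (pointOfVec k z hz).left =
      (pointOfVec k (fun j => σ (z j)) (algHom_comp_ne_zero σ hz)).left := by
  have hi := apply_firstNe_ne_zero z hz
  have hσi : aeval (fun j => σ (z j)) (X (firstNe z hz) : MvPolynomial (Fin (n + 1)) k) ≠ 0 := by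
    simpa using hi
  rw [pointOfVec_eq_chartPoint (fun j => σ (z j)) _ (X_mem (firstNe z hz)) one_pos hσi]
  exact specMap_comp_chartPoint_left σ _ _ z _ hσi

end Literature.AlgebraicGeometry.Motives.ProjectiveSpace

namespace Literature.AlgebraicGeometry.Resolution

attribute [local instance] MvPolynomial.gradedAlgebra

/-! ## Definedness descends along flat dominant morphisms -/

/-- **Definedness of `(z₀ : … : zₙ)` descends along a flat dominant morphism** `π : X' → X`: if
`(π^♯z₀ : … : π^♯zₙ)` is defined at `x'` then `(z₀ : … : zₙ)` is defined at `π x'` (regularity of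
rational functions descends along faithfully flat local homomorphisms). [folklore] -/
theorem IsDefinedAt.of_functionFieldMap {X X' : Scheme.{u}} [IsIntegral X] [IsIntegral X'] {n : ℕ}
    {z : Fin (n + 1) → X.functionField} (π : X' ⟶ X) [IsDominant π] [Flat π] {x' : X'}
    (h : IsDefinedAt (fun l => RatFn.functionFieldMap π (z l)) x') : IsDefinedAt z (π x') := by
  obtain ⟨i, hi⟩ := h
  obtain ⟨hi0, hl⟩ := (mem_lsChart_iff _).mp hi
  refine ⟨i, (mem_lsChart_iff z).mpr ⟨fun h0 => hi0 (by simp [h0]), fun l => ?_⟩⟩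
  have := hl l
  rw [← map_div₀] at this
  exact RatFn.IsRegularAt.of_functionFieldMap π this

namespace ProjModel

variable {k K : Type u} [Field k] [Field K] [Algebra k K]

/-! ## A rational map defined on an open is a morphism of `k`-schemes there -/

/-- **The rational map `N₂ ⋯→ M₁ ⊆ ℙⁿ_k` is a morphism of `k`-schemes on every open where it
is defined, compatibly with the `K`-points** (Piltant 2013, §3: birational correspondences of
models; Hartshorne II Thm. 7.1). Here `M₁ ↪ ℙⁿ_k` is a closed `k`-immersion, `w ∈ Kⁿ⁺¹` are
homogeneous coordinates of the generic point of `M₁`, and the rational map on `N₂` is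
`(w₀ : … : wₙ)` read in `K(N₂) ≅ K`; on the open `W` where it is defined it is a morphism
`W → ℙⁿ_k` (`toProjOfVec`) with generic point `(w₀ : … : wₙ)`, which factors through `M₁`.
[cite: Piltant2013, Lemma 3.3] -/
theorem exists_hom_of_isDefinedAt (N₂ M₁ : ProjModel k K) {n : ℕ}
    (ι₁ : M₁.X ⟶ Proj (Segre.grading (Fin (n + 1)) k)) [IsClosedImmersion ι₁]
    (hι₁ : ι₁ ≫ Segre.toSpec (Fin (n + 1)) k = M₁.π) (w : Fin (n + 1) → K) (hw : w ≠ 0)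
    (hgen₁ : M₁.gen ≫ ι₁ = (ProjectiveSpace.pointOfVec k w hw).left)
    (W : N₂.X.Opens) (hWne : (W : Set N₂.X).Nonempty)
    (hW : ∀ y ∈ W, IsDefinedAt (fun l => N₂.funFieldAlgEquiv.symm (w l)) y) :
    ∃ f₁ : (W : Scheme.{u}) ⟶ M₁.X, f₁ ≫ M₁.π = W.ι ≫ N₂.π ∧ N₂.genLift hWne ≫ f₁ = M₁.gen := by
  classical
  let e : K ≃ₐ[k] N₂.X.functionField := N₂.funFieldAlgEquiv.symm
  let z : Fin (n + 1) → N₂.X.functionField := fun l => e (w l)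
  have hz : z ≠ 0 := ProjectiveSpace.algHom_comp_ne_zero e.toAlgHom hw
  haveI : Nonempty (W : Scheme.{u}) := hWne.to_subtype
  haveI : IsIntegral (W : Scheme.{u}) := isIntegral_of_isOpenImmersion W.ι
  haveI : IsDominant W.ι := ⟨by rw [DenseRange, Scheme.Opens.range_ι]; exact W.2.dense hWne⟩
  /- the morphism `rW : W → ℙⁿ_k` -/
  let zW : Fin (n + 1) → (W : Scheme.{u}).functionField := fun l => RatFn.functionFieldMap W.ι (z l)
  have hdefW : ∀ y : (W : Scheme.{u}), IsDefinedAt zW y := fun y =>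
    (hW (W.ι y) y.2 : IsDefinedAt z (W.ι y)).functionFieldMap W.ι
  have hzW : zW ≠ 0 := by
    obtain ⟨i, hi⟩ := Function.ne_iff.mp hz
    exact Function.ne_iff.mpr ⟨i, (map_ne_zero _).mpr hi⟩
  let fW : (W : Scheme.{u}) ⟶ Spec (.of k) := W.ι ≫ N₂.π
  let rW := toProjOfVec zW fW hdefW
  /- the `k`-algebra structure on `K(W)` and the generic point of `rW` -/
  let τ : N₂.X.functionField →+* (W : Scheme.{u}).functionField := RatFn.functionFieldMap W.ι
  letI algW : Algebra k (W : Scheme.{u}).functionField :=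
    (τ.comp (algebraMap k N₂.X.functionField)).toAlgebra
  let τₐ : N₂.X.functionField →ₐ[k] (W : Scheme.{u}).functionField := ⟨τ, fun _ => rfl⟩
  let θ : K →ₐ[k] (W : Scheme.{u}).functionField := τₐ.comp e.toAlgHom
  have hgenW : (W : Scheme.{u}).fromSpecStalk (genericPoint (W : Scheme.{u})) ≫ fW =
      Spec.map (CommRingCat.ofHom (algebraMap k (W : Scheme.{u}).functionField)) := by
    rw [RingHom.algebraMap_toAlgebra,
      show CommRingCat.ofHom (τ.comp (algebraMap k N₂.X.functionField)) =
        CommRingCat.ofHom (algebraMap k N₂.X.functionField) ≫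
          CommRingCat.ofHom (RatFn.functionFieldMap W.ι) from rfl,
      Spec.map_comp, ← N₂.fromSpecStalk_genericPoint_π,
      specMap_functionFieldMap_fromSpecStalk_assoc W.ι]
  have hgenrW : (W : Scheme.{u}).fromSpecStalk (genericPoint (W : Scheme.{u})) ≫ rW =
      (ProjectiveSpace.pointOfVec k zW hzW).left :=
    fromSpecStalk_genericPoint_toProjOfVec zW fW hdefW hgenW hzW
  have hptθ : (ProjectiveSpace.pointOfVec k zW hzW).left =
      Spec.map (CommRingCat.ofHom θ.toRingHom) ≫ M₁.gen ≫ ι₁ := by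
    rw [hgen₁]
    exact (ProjectiveSpace.specMap_comp_pointOfVec_left θ w hw).symm
  /- `rW` factors through `M₁ ↪ ℙⁿ_k` -/
  have hrange : Set.range rW ⊆ Set.range ι₁ := by
    have hξ : rW (genericPoint (W : Scheme.{u})) ∈ Set.range ι₁ := by
      have h1 := congrArg (fun φ => φ (closedPoint _)) hgenrW
      simp only [Scheme.Hom.comp_apply, Scheme.fromSpecStalk_closedPoint] at h1
      rw [h1, hptθ]
      exact ⟨_, rfl⟩
    rintro _ ⟨y, rfl⟩
    have hy : y ∈ closure ({genericPoint (W : Scheme.{u})} : Set (W : Scheme.{u})) := by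
      rw [genericPoint_closure]; trivial
    have h2 : rW y ∈ closure (rW '' {genericPoint (W : Scheme.{u})}) :=
      map_mem_closure rW.continuous hy fun x hx => Set.mem_image_of_mem rW hx
    rw [Set.image_singleton] at h2
    exact (ι₁.isClosedEmbedding.isClosed_range.closure_subset_iff.mpr
      (Set.singleton_subset_iff.mpr hξ)) h2
  let f₁ : (W : Scheme.{u}) ⟶ M₁.X := IsClosedImmersion.liftOfRange ι₁ rW hrange
  have hf₁ι : f₁ ≫ ι₁ = rW := IsClosedImmersion.liftOfRange_fac _ _ _
  have hf₁ : f₁ ≫ M₁.π = W.ι ≫ N₂.π := by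
    rw [← hι₁, ← Category.assoc, hf₁ι]
    exact toProjOfVec_toSpec zW fW hdefW
  /- the `K`-point of `W` and its compatibility with `gen_{M₁}` -/
  let sW : Spec (CommRingCat.of K) ⟶ W := N₂.genLift hWne
  have h₁ : sW ≫ W.ι = N₂.gen := N₂.genLift_ι hWne
  let eW : CommRingCat.of K ⟶ (W : Scheme.{u}).functionField :=
    N₂.funFieldIso.inv ≫ CommRingCat.ofHom (RatFn.functionFieldMap W.ι)
  have heWθ : eW = CommRingCat.ofHom θ.toRingHom := by ext b; rfl
  have hsW : Spec.map eW ≫ sW = (W : Scheme.{u}).fromSpecStalk (genericPoint (W : Scheme.{u})) := by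
    rw [← cancel_mono W.ι, Category.assoc, h₁, ← specMap_functionFieldMap_fromSpecStalk W.ι,
      N₂.fromSpecStalk_genericPoint_eq, Spec.map_comp_assoc]
    rfl
  haveI : IsIso eW :=
    IsIso.comp_isIso' inferInstance
      (isIso_of_bijective _ (RatFn.functionFieldMap_bijective_of_isOpenImmersion W.ι))
  have h₂ : sW ≫ f₁ = M₁.gen := by
    rw [← cancel_mono ι₁, Category.assoc, hf₁ι, ← cancel_epi (Spec.map eW), ← Category.assoc,
      hsW, hgenrW, hptθ, heWθ]
  exact ⟨f₁, hf₁, h₂⟩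

/-! ## A morphism of `k`-schemes from an open forces definedness -/

/-- **A `k`-morphism `g : V → B` from a non-empty open `V ⊆ A`, compatible with the `K`-points,
forces the rational map `A ⋯→ B ⊆ ℙⁿ_k` (`(w₀ : … : wₙ)` read in `K(A) ≅ K`) to be defined at
every point of `V`** (`isDefinedAt_of_comp_eq_pointOfVec` on the integral scheme `V`, transported
back along the open immersion `V ↪ A`). [cite: Hartshorne1977, II Thm. 7.1 (a)] -/
theorem isDefinedAt_of_hom (A B : ProjModel k K) {n : ℕ}
    (ιB : B.X ⟶ Proj (Segre.grading (Fin (n + 1)) k)) (w : Fin (n + 1) → K) (hw : w ≠ 0)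
    (hgenB : B.gen ≫ ιB = (ProjectiveSpace.pointOfVec k w hw).left)
    (V : A.X.Opens) (hVne : (V : Set A.X).Nonempty) (g : (V : Scheme.{u}) ⟶ B.X)
    (hg : A.genLift hVne ≫ g = B.gen) {a : A.X} (ha : a ∈ V) :
    IsDefinedAt (fun l => A.funFieldAlgEquiv.symm (w l)) a := by
  classical
  let e : K ≃ₐ[k] A.X.functionField := A.funFieldAlgEquiv.symm
  let z : Fin (n + 1) → A.X.functionField := fun l => e (w l)
  have hz : z ≠ 0 := ProjectiveSpace.algHom_comp_ne_zero e.toAlgHom hw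
  haveI : Nonempty (V : Scheme.{u}) := hVne.to_subtype
  haveI : IsIntegral (V : Scheme.{u}) := isIntegral_of_isOpenImmersion V.ι
  haveI : IsDominant V.ι := ⟨by rw [DenseRange, Scheme.Opens.range_ι]; exact V.2.dense hVne⟩
  let zV : Fin (n + 1) → (V : Scheme.{u}).functionField := fun l => RatFn.functionFieldMap V.ι (z l)
  have hzV : zV ≠ 0 := by
    obtain ⟨i, hi⟩ := Function.ne_iff.mp hz
    exact Function.ne_iff.mpr ⟨i, (map_ne_zero _).mpr hi⟩
  let rV : (V : Scheme.{u}) ⟶ Proj (Segre.grading (Fin (n + 1)) k) := g ≫ ιB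
  -- the `k`-algebra structure on `K(V)`
  let τ : A.X.functionField →+* (V : Scheme.{u}).functionField := RatFn.functionFieldMap V.ι
  letI algV : Algebra k (V : Scheme.{u}).functionField :=
    (τ.comp (algebraMap k A.X.functionField)).toAlgebra
  let τₐ : A.X.functionField →ₐ[k] (V : Scheme.{u}).functionField := ⟨τ, fun _ => rfl⟩
  let θ : K →ₐ[k] (V : Scheme.{u}).functionField := τₐ.comp e.toAlgHom
  -- the `K`-point of `V` and `Spec K(V) → V`
  let sV : Spec (CommRingCat.of K) ⟶ V := A.genLift hVne
  let eV : CommRingCat.of K ⟶ (V : Scheme.{u}).functionField :=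
    A.funFieldIso.inv ≫ CommRingCat.ofHom (RatFn.functionFieldMap V.ι)
  have heVθ : eV = CommRingCat.ofHom θ.toRingHom := by ext b; rfl
  have hsV : Spec.map eV ≫ sV = (V : Scheme.{u}).fromSpecStalk (genericPoint (V : Scheme.{u})) := by
    rw [← cancel_mono V.ι, Category.assoc, genLift_ι, ← specMap_functionFieldMap_fromSpecStalk V.ι,
      A.fromSpecStalk_genericPoint_eq, Spec.map_comp_assoc]
    rfl
  haveI : IsIso eV :=
    IsIso.comp_isIso' inferInstance
      (isIso_of_bijective _ (RatFn.functionFieldMap_bijective_of_isOpenImmersion V.ι))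
  -- the generic point of `rV` is `(w₀ : … : wₙ)` read in `K(V)`
  have hr : (V : Scheme.{u}).fromSpecStalk (genericPoint (V : Scheme.{u})) ≫ rV =
      (ProjectiveSpace.pointOfVec k zV hzV).left := by
    rw [← hsV, Category.assoc, reassoc_of% hg, hgenB, heVθ]
    exact ProjectiveSpace.specMap_comp_pointOfVec_left θ w hw
  -- hence `zV` is defined everywhere on `V`, and `z` at `a`
  have hdefV : IsDefinedAt zV (⟨a, ha⟩ : V) := isDefinedAt_of_comp_eq_pointOfVec zV rV hzV hr _
  exact IsDefinedAt.of_functionFieldMap V.ι hdefV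

/-! ## Centres of `𝒪_{A,a}` versus definedness in coordinates -/

/-- A lift `Spec 𝒪_{A,a} → B` restricting to `gen_B` along `Spec K → Spec 𝒪_{A,a}` makes its value
at the closed point a centre of `𝒪_{A,a} ⊆ K` on `B` (`isCentreOf_of_lift`, transported along
`𝒪_{A,a} ≅ stalkSubring A a`). [cite: ZariskiSamuel1960, Ch. VI §17] -/
theorem isCentreOf_of_stalkLift {A B : ProjModel k K} (a : A.X)
    (l : Spec (A.X.presheaf.stalk a) ⟶ B.X)
    (hgen : Spec.map (CommRingCat.ofHom (A.stalkToK a)) ≫ l = B.gen) :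
    B.IsCentreOf (A.stalkSubring a) (l (closedPoint (A.X.presheaf.stalk a))) := by
  let ε : A.X.presheaf.stalk a ⟶ CommRingCat.of (A.stalkSubring a) :=
    CommRingCat.ofHom (A.stalkToSubring a)
  haveI : IsLocalHom ε.hom := ⟨fun t ht => (A.isUnit_stalkEquiv_iff a t).mp ht⟩
  have hε : specKToSubring (A.stalkSubring a) ≫ Spec.map ε =
      Spec.map (CommRingCat.ofHom (A.stalkToK a)) := by
    rw [← Spec.map_comp]; rfl
  have h1 : specKToSubring (A.stalkSubring a) ≫ (Spec.map ε ≫ l) = B.gen := by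
    rw [← Category.assoc, hε, hgen]
  have h2 := isCentreOf_of_lift (Spec.map ε ≫ l) h1
  rwa [Scheme.Hom.comp_apply, Spec_closedPoint] at h2

/-- Conversely a centre of `𝒪_{A,a}` on `B` yields `l : Spec 𝒪_{A,a} → B` restricting to `gen_B`
and lying over `Spec 𝒪_{A,a} → A → Spec k`. [cite: ZariskiSamuel1960, Ch. VI §17] -/
theorem IsCentreOf.exists_stalkLift {A B : ProjModel k K} {a : A.X} {b : B.X}
    (h : B.IsCentreOf (A.stalkSubring a) b) :
    ∃ l : Spec (A.X.presheaf.stalk a) ⟶ B.X,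
      Spec.map (CommRingCat.ofHom (A.stalkToK a)) ≫ l = B.gen ∧ l (closedPoint _) = b ∧
      l ≫ B.π = A.X.fromSpecStalk a ≫ A.π := by
  obtain ⟨l, hl, hlb⟩ := h.exists_lift
  -- `Spec (stalkSubring A a) ≅ Spec 𝒪_{A,a}`
  let ε : A.X.presheaf.stalk a ⟶ CommRingCat.of (A.stalkSubring a) :=
    CommRingCat.ofHom (A.stalkToSubring a)
  let ε' : CommRingCat.of (A.stalkSubring a) ⟶ A.X.presheaf.stalk a :=
    CommRingCat.ofHom (A.stalkEquiv a).symm.toRingHom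
  have hεε' : ε ≫ ε' = 𝟙 _ := by
    ext t; exact (A.stalkEquiv a).symm_apply_apply t
  have hε'K : ε' ≫ CommRingCat.ofHom (A.stalkToK a) = CommRingCat.ofHom (A.stalkSubring a).subtype := by
    ext z; exact A.stalkToK_stalkEquiv_symm a z
  have hε : specKToSubring (A.stalkSubring a) ≫ Spec.map ε =
      Spec.map (CommRingCat.ofHom (A.stalkToK a)) := by
    rw [← Spec.map_comp]; rfl
  -- `lA : Spec (stalkSubring A a) ≅ Spec 𝒪_{A,a} → A` and the common `k`-structure
  let lA : Spec (CommRingCat.of (A.stalkSubring a)) ⟶ A.X := Spec.map ε ≫ A.X.fromSpecStalk a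
  have hlA : specKToSubring (A.stalkSubring a) ≫ lA = A.gen := by
    rw [← Category.assoc, hε, specMap_stalkToK_fromSpecStalk]
  have hπ : l ≫ B.π = lA ≫ A.π := lift_comp_π_eq lA hlA l hl
  have h4 : Spec.map (CommRingCat.ofHom (A.stalkToK a)) ≫ Spec.map ε' =
      specKToSubring (A.stalkSubring a) := by
    rw [← Spec.map_comp]; exact congrArg Spec.map hε'K
  refine ⟨Spec.map ε' ≫ l, ?_, ?_, ?_⟩
  · rw [← Category.assoc, h4]
    exact hl
  · haveI : IsLocalHom ε'.hom := ⟨fun t ht => by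
      have h2 : (A.stalkEquiv a) (ε'.hom t) = t := by
        change (A.stalkEquiv a) ((A.stalkEquiv a).symm t) = t
        exact (A.stalkEquiv a).apply_symm_apply t
      have h3 := ht.map (A.stalkEquiv a)
      rw [h2] at h3
      exact h3⟩
    rw [Scheme.Hom.comp_apply, Spec_closedPoint, hlb]
  · rw [Category.assoc, hπ, ← Category.assoc, ← Category.assoc, ← Spec.map_comp, hεε', Spec.map_id,
      Category.id_comp]

/-- **`𝒪_{A,a}` has a centre on `B` iff the rational map `A ⋯→ B ⊆ ℙⁿ_k` is defined at `a` in
coordinates** (Zariski–Samuel II, Ch. VI §17: a point `P` of `V` corresponds to `P'` of `V'` in the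
birational correspondence iff … `𝒪_P ⊇ 𝒪_{P'}`; Hartshorne II Thm. 7.1: morphisms to `ℙⁿ`).
(→): `Spec 𝒪_{A,a} → B` spreads out to a `k`-morphism from an open neighbourhood (Mathlib
`spread_out_of_isGermInjective'`), which forces definedness (`isDefinedAt_of_hom`).
(←): on the open of definition the rational map is a morphism `W → B` (`exists_hom_of_isDefinedAt`),
and `Spec 𝒪_{A,a} → W → B` exhibits the centre. [cite: ZariskiSamuel1960, Ch. VI §17] -/
theorem hasCentre_stalkSubring_iff_isDefinedAt (A B : ProjModel k K) {n : ℕ}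
    (ιB : B.X ⟶ Proj (Segre.grading (Fin (n + 1)) k)) [IsClosedImmersion ιB]
    (hιB : ιB ≫ Segre.toSpec (Fin (n + 1)) k = B.π) (w : Fin (n + 1) → K) (hw : w ≠ 0)
    (hgenB : B.gen ≫ ιB = (ProjectiveSpace.pointOfVec k w hw).left) (a : A.X) :
    B.HasCentre (A.stalkSubring a) ↔ IsDefinedAt (fun l => A.funFieldAlgEquiv.symm (w l)) a := by
  constructor
  · rintro ⟨b, hb⟩
    obtain ⟨l, hl, -, hlπ⟩ := hb.exists_stalkLift
    obtain ⟨V, haV, g, hgl, hgπ⟩ :=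
      spread_out_of_isGermInjective' (sX := A.π) (sY := B.π) l hlπ
    have hVne : (V : Set A.X).Nonempty := ⟨a, haV⟩
    refine isDefinedAt_of_hom A B ιB w hw hgenB V hVne g ?_ haV
    -- `genLift ≫ g = gen_B`: both `K`-points of `V` agree after `V ↪ A`
    have hlift : A.genLift hVne = Spec.map (CommRingCat.ofHom (A.stalkToK a)) ≫
        V.fromSpecStalkOfMem a haV := by
      rw [← cancel_mono V.ι, genLift_ι, Category.assoc, Scheme.Opens.fromSpecStalkOfMem_ι,
        specMap_stalkToK_fromSpecStalk]
    rw [hlift, Category.assoc, ← hgl, hl]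
  · intro ha
    let z : Fin (n + 1) → A.X.functionField := fun l => A.funFieldAlgEquiv.symm (w l)
    have hz' : ∃ i, z i ≠ 0 := by
      obtain ⟨i, hi⟩ := ha
      exact ⟨i, ne_zero_of_mem_lsChart z hi⟩
    let W : A.X.Opens := ⟨{y | IsDefinedAt z y}, by
      have h := (isClosed_setOf_not_isDefinedAt hz').isOpen_compl
      rwa [Set.compl_setOf, funext fun x => propext not_not] at h⟩
    have haW : a ∈ W := ha
    have hWne : (W : Set A.X).Nonempty := ⟨a, haW⟩
    obtain ⟨f₁, -, hgen⟩ := exists_hom_of_isDefinedAt A B ιB hιB w hw hgenB W hWne fun y hy => hy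
    have hlift : A.genLift hWne = Spec.map (CommRingCat.ofHom (A.stalkToK a)) ≫
        W.fromSpecStalkOfMem a haW := by
      rw [← cancel_mono W.ι, genLift_ι, Category.assoc, Scheme.Opens.fromSpecStalkOfMem_ι,
        specMap_stalkToK_fromSpecStalk]
    refine ⟨_, isCentreOf_of_stalkLift a (W.fromSpecStalkOfMem a haW ≫ f₁) ?_⟩
    rw [← Category.assoc, ← hlift, hgen]

/-- **The intrinsic indeterminacy locus of `A ⋯→ B` is closed.** [cite: ZariskiSamuel1960, Ch. VI §17] -/
theorem isClosed_setOf_not_hasCentre (A B : ProjModel k K) :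
    IsClosed {a : A.X | ¬ B.HasCentre (A.stalkSubring a)} := by
  obtain ⟨n, ιB', hιB'⟩ := B.isProjectiveOver
  let ιB : B.X ⟶ Proj (Segre.grading (Fin (n + 1)) k) := ιB'.left
  haveI : IsClosedImmersion ιB := hιB'
  have hιBw : ιB ≫ Segre.toSpec (Fin (n + 1)) k = B.π := Over.w ιB'
  let P₁ : AlgPoints (projectiveSpace n k) K := genOver B ≫ ιB'
  obtain ⟨w, hw, hPw⟩ := ProjectiveSpace.exists_eq_pointOfVec (k := k) (L := K) P₁
  have hgenB : B.gen ≫ ιB = (ProjectiveSpace.pointOfVec k w hw).left := by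
    rw [← hPw]; rfl
  let z : Fin (n + 1) → A.X.functionField := fun l => A.funFieldAlgEquiv.symm (w l)
  have hz : z ≠ 0 := ProjectiveSpace.algHom_comp_ne_zero A.funFieldAlgEquiv.symm.toAlgHom hw
  have hz' : ∃ i, z i ≠ 0 := by
    by_contra h
    push Not at h
    exact hz (funext h)
  have heq : {a : A.X | ¬ B.HasCentre (A.stalkSubring a)} = {a | ¬ IsDefinedAt z a} := by
    ext a
    simp only [Set.mem_setOf_eq, hasCentre_stalkSubring_iff_isDefinedAt A B ιB hιBw w hw hgenB a]
    rfl
  rw [heq]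
  exact isClosed_setOf_not_isDefinedAt hz'

/-- The generic point is never a point of indeterminacy. [folklore] -/
theorem hasCentre_stalkSubring_genericPoint (A B : ProjModel k K) :
    B.HasCentre (A.stalkSubring (genericPoint A.X)) := by
  rw [stalkSubring_genericPoint]
  exact ⟨_, B.isCentreOf_top_genericPoint⟩

-- Along a morphism of models `B' → B` the indeterminacy locus of `A ⋯→ B` can only shrink: this is
-- `ProjModel.HasCentre.map` (ProjectiveModelsCentresLocal.lean), applied to `O := A.stalkSubring a`.

/-- **A morphism of models `η : B → A` which is a local isomorphism at `b` makes `A ⋯→ B` defined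
at `η b`.** [cite: Piltant2013, Lemma 3.3] -/
theorem hasCentre_of_isIso_stalkMap {A B : ProjModel k K} (η : B.Hom A) (b : B.X)
    [IsIso (η.f.stalkMap b)] : B.HasCentre (A.stalkSubring (η.f b)) :=
  ⟨b, by
    unfold IsCentreOf
    rw [stalkSubring_eq_of_isIso_stalkMap η b]
    exact SubringDominates.refl _⟩

end ProjModel

end Literature.AlgebraicGeometry.Resolution

end
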